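import Summits.CriticalPhenomena.Ising3DConformalLimit.Theorems.AnomalousForcesInteractionGaussianLimitIsFreeStubIffCrux
import HarnessLib

/-!
# Skeleton (line `registered` = birth, v12 by lead c5) for the crux
`AnomalousForcesInteraction.GaussianLimitIsFree` (item stmt-CriticalPhenomena-2601, rank 3; shared with
routes `OctaveForgetting`, `OrthogonalFrameTP2`)

The crux (GF): for every renormalisation `ρ > 0` on `(0,1]`, `Δ` and `S`, if `S` is a pointwise scaling
limit of `criticalCorr 3` with non-degenerate two-point function, translation invariant, scale covariant
with dimension `Δ` and with connected four-point function `U₄ ≡ 0` on non-coincident configurations,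
then `Δ = 1/2`.

## Composition (unchanged idea since birth): Gaussianity ∘ Markov inheritance ∘ Gaussian–Markov rigidity

Everything except the inheritance is a THEOREM of the tree (leads c2–c5): normalisation and the Gaussian
dichotomy (`gaussian_normalised_eq_gff`: `S = (√A)ⁿ·W_Δ'`, `Δ' ∈ [1/2,3/4]`); the realising sequence
(`exists_plusMeasure_holds`, `exists_limitLaw`: the Minlos limit law `μ` of
`μ_δ = spinFieldLaw ν (box 3 ⌊δ⁻²⌋) δ (ρ δ)`, `ν` the critical plus DLR state); Newman Gaussianity of `μ`
(`stub_newmanGaussianity`, p147011); Gaussian rigidity from the `L²` decoupling inequality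
(D_ε) `|E[ω(w)ω(v)]| ≤ ‖E[ω(w) | 𝒜((∂B)^ε)]‖₂ ‖ω(v)‖₂` across the unit sphere
(`delta_eq_half_of_sphereDecoupling`, p166595); (D_ε) for every lattice term `μ_δ`, `δ < ε`
(`sphereDecoupling_approximants`, p167469); convergence of covariances along the sequence and the passage
of (D_ε) to the limit GIVEN an upper bound on the lattice explained variance (`sphereDecoupling_of_usc`,
`GaussianLimitIsFree_of_usc`, …ExplainedVariance.lean, lead c5).

## v12 (lead c5): ONE registered stub — upper semicontinuity of the explained variance

Markov inheritance along the realising sequence is CONTINUITY at `δ = 0⁺` of the explained variance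
`e_δ(w,ε) = ∫ (μ_δ[ω(w) | 𝒜((∂B)^ε)])² dμ_δ` of an interior observable by the collar events.  Its LOWER
semicontinuity (`lim inf_δ e_δ ≥ e`, the continuum value) is a theorem (`stub_explainedVariance_lsc`:
linear predictors + the Gaussian projection theorem).  The stub below is the UPPER half, `lim sup_δ e_δ ≤ e`,
for `w` supported in the open unit ball, in the anomalous case `Δ > 1/2` (at `Δ = 1/2` the crux holds
outright, so the stub stays TRUE iff the crux is: it is vacuous unless the nearest-neighbour critical model
has a Gaussian scaling limit with `Δ ∈ (1/2, 3/4]`, and in that case it is false, `not_sphereDecoupling_of_ne_half`).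
Content: the `≍ ε δ⁻³` collar spins, which under `μ_δ` generate the collar σ-algebra (every single spin is
seen through bumps of radius `< δ`), must not predict `ω(w)` better, asymptotically, than the smeared collar
field does under `μ`.  Implied by crux stmt-CriticalPhenomena-11236 (`MarkovInheritance`) only through the
crux; no estimate of this kind is in print (Aizenman, CDM 2020 (2021) §3, §11; presearch in the lead notes);
reflection positivity yields only the lower half (half-space identity `‖E_δ[F | plane]‖² = E_δ[F·θF]`).
Blocker of record: stmt-CriticalPhenomena-11236.

**Status certificate (p173004, …StubIffCrux.lean): `usc_iff_GaussianLimitIsFree : stub ↔ crux`.**  The stub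
below is kernel-checked EQUIVALENT to the crux (converse via `not_hasNontrivialU4_of_wickForm`): the line has
isolated where a proof must work but cannot make the crux cheaper; closing it needs a genuinely new lattice
estimate (or a different line, e.g. an interaction-uniform random-current intersection argument for
`Δ < 3/4`, which the barrier `LongRangeTrivialityOnZ3` — witnesses only at `Δ ≥ 3/4` — does not exclude).
-/

noncomputable section

namespace Summit.CriticalPhenomena.Ising3DConformalLimit.Cruxes.GaussianLimitIsFree.Birth

open MeasureTheory Filter Set
open Literature.MathematicalPhysics.QuantumLattice
open Literature.Probability.LatticeModels
open Summit.CriticalPhenomena.Ising3DConformalLimit.Theses.AnomalousForcesInteraction (GaussianLimitIsFree)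

/-- **The single stub of v12 — upper semicontinuity of the explained variance along the realising
sequence (the open half of Markov inheritance, Gaussian anomalous case).**  For a normalised
non-degenerate translation-invariant scale-covariant pointwise limit `S = (√A)ⁿ·W_Δ` of `criticalCorr 3`
along `ρ > 0` with `Δ > 1/2`, a centred GAUSSIAN probability law `μ` on `𝒮'(ℝ³)` with all moments,
exponential moments and moment densities `S` which is the limit in law of
`μ_δ = spinFieldLaw ν (box 3 ⌊δ⁻²⌋) δ (ρ δ)` as `δ → 0⁺` (`ν ∈ isingGibbsMeasures 3 β_c 0` with the plus
correlations), every `ε > 0`, every `w` supported in the open unit ball and every `η > 0`: eventually as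
`δ → 0⁺`, `∫ (μ_δ[ω(w) | fieldSigma ((∂B)^ε)])² dμ_δ ≤ ∫ (μ[ω(w) | fieldSigma ((∂B)^ε)])² dμ + η`.
The reverse inequality (`lim inf ≥`) is the tree theorem `stub_explainedVariance_lsc`.
[cite: Rozanov1982, Ch. 2 §1.1 (1.1)–(1.3), §3.1 (3.1)–(3.3)] -/
theorem stub_explainedVariance_usc :
    ∀ (ρ : ℝ → ℝ) (Δ A : ℝ) (S : Literature.Probability.LatticeModels.CorrFamily 3) (μ : MeasureTheory.Measure (Literature.MathematicalPhysics.QuantumLattice.FieldConfig (EuclideanSpace ℝ (Fin 3)))), (∀ δ ∈ Set.Ioc (0:ℝ) 1, 0 < ρ δ) → Literature.Probability.LatticeModels.HasPointwiseScalingLimit (Literature.Probability.LatticeModels.criticalCorr 3) ρ S → (∀ n z, z ∉ Literature.Probability.LatticeModels.NonCoincident 3 n → S n z = 0) → Literature.Probability.LatticeModels.IsNondegenerateTwoPoint S → Literature.Probability.LatticeModels.IsTranslationInvariant S → Literature.Probability.LatticeModels.IsScaleCovariant Δ S → 1 / 2 < Δ → 0 < A → (∀ (n : ℕ) (x : Fin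 n → EuclideanSpace ℝ (Fin 3)), S n x = Real.sqrt A ^ n * Summit.CriticalPhenomena.Ising3DConformalLimit.MoebiusLimitExistsOnlyInteraction.wickPower Δ n x) → MeasureTheory.IsProbabilityMeasure μ → Literature.MathematicalPhysics.QuantumLattice.HasAllMoments μ → (∀ f : SchwartzMap (EuclideanSpace ℝ (Fin 3)) ℝ, MeasureTheory.Integrable (fun ω : Literature.MathematicalPhysics.QuantumLattice.FieldConfig (EuclideanSpace ℝ (Fin 3)) => Real.exp (ω f)) μ) → (∀ (n : ℕ) (f : Fin n → SchwartzMap (EuclideanSpace ℝ (Fin 3)) ℝ), Literature.MathematicalPhysics.QuantumLattice.moment μ n f = ∫ x : Fin n → EuclideanSpace ℝ (Fin 3), S n x * ∏ i, f i (x i)) → Literature.MathematicalPhysics.QuantumLattice.IsGaussianField μ → ∀ (ν : MeasureTheory.Measure (Literature.Probability.LatticeModels.SpinConfig (Literature.Probability.LatticeModels.Site 3))), ν ∈ Literature.Probability.LatticeModels.isingGibbsMeasures 3 (Literature.Probability.LatticeModels.criticalBeta 3) 0 → (∀ B : Finset (Literature.Probability.LatticeModels.Site 3), Literature.Probability.LatticeModels.spinCorr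 ν B = Literature.Probability.LatticeModels.plusCorr 3 (Literature.Probability.LatticeModels.criticalBeta 3) 0 B) → Literature.MathematicalPhysics.QuantumLattice.TendstoInLaw (fun δ : ℝ => Literature.MathematicalPhysics.QuantumLattice.spinFieldLaw ν (Literature.Probability.LatticeModels.box 3 ⌊δ⁻¹ ^ 2⌋₊) δ (ρ δ)) (nhdsWithin (0 : ℝ) (Set.Ioi 0)) μ → ∀ (ε : ℝ), 0 < ε → ∀ (w : SchwartzMap (EuclideanSpace ℝ (Fin 3)) ℝ), tsupport ⇑w ⊆ Metric.ball (0 : EuclideanSpace ℝ (Fin 3)) 1 → ∀ (η : ℝ), 0 < η → Filter.Eventually (fun δ : ℝ => ∫ ω, (MeasureTheory.condExp (Literature.MathematicalPhysics.QuantumLattice.fieldSigma (Metric.thickening ε (Metric.sphere (0 : EuclideanSpace ℝ (Fin 3)) 1))) (Literature.MathematicalPhysics.QuantumLattice.spinFieldLaw ν (Literature.Probability.LatticeModels.box 3 ⌊δ⁻¹ ^ 2⌋₊) δ (ρ δ)) (fun ω : Literature.MathematicalPhysics.QuantumLattice.FieldConfig (EuclideanSpace ℝ (Fin 3)) => ω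 w)) ω ^ 2 ∂(Literature.MathematicalPhysics.QuantumLattice.spinFieldLaw ν (Literature.Probability.LatticeModels.box 3 ⌊δ⁻¹ ^ 2⌋₊) δ (ρ δ)) ≤ (∫ ω, (MeasureTheory.condExp (Literature.MathematicalPhysics.QuantumLattice.fieldSigma (Metric.thickening ε (Metric.sphere (0 : EuclideanSpace ℝ (Fin 3)) 1))) μ (fun ω : Literature.MathematicalPhysics.QuantumLattice.FieldConfig (EuclideanSpace ℝ (Fin 3)) => ω w)) ω ^ 2 ∂μ) + η) (nhdsWithin (0 : ℝ) (Set.Ioi 0)) := by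
  sorry

/-- **The crux `GaussianLimitIsFree` BY NAME** (route `AnomalousForcesInteraction`, item
stmt-CriticalPhenomena-2601; shared with `OctaveForgetting`, `OrthogonalFrameTP2`) — the skeleton's concluding
declaration.  Its ONLY debt is the `sorry` inside `stub_explainedVariance_usc`; the composition
`GaussianLimitIsFree_of_usc` is a tree theorem (…ExplainedVariance.lean). [folklore] -/
theorem GaussianLimitIsFree_of : GaussianLimitIsFree :=
  GaussianLimitIsFree_of_usc stub_explainedVariance_usc

end Summit.CriticalPhenomena.Ising3DConformalLimit.Cruxes.GaussianLimitIsFree.Birth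

end
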